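import Summits.BirchSwinnertonDyer.BirchSwinnertonDyer.Theorems.ResidualThetaTransportAtTwoThetaLayerLambdaCongruenceAtTwoOfSignedMuAnalytic
import Literature.NumberTheory.EllipticCurves.IsogenyFrobeniusTraceHoldsProofs
import HarnessLib

/-!
# Crux Kan⁺ `ThetaLayerLambdaCongruenceAtTwo` (stmt-BirchSwinnertonDyer-20688, route ResidualThetaTransportAtTwo), line `birth`:
# the crux BY NAME from SEVEN named print facts + the route item 21437 — the Faltings binder is a TREE THEOREM

Width seat bsd-wall-rtt-p3-w3 g5 (`--supports stmt-BirchSwinnertonDyer-20688`; closes nothing; THEOREMS ONLY — no `def`,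
no `sorry`; every remaining hypothesis is a Literature named fact BY NAME or a route decl BY NAME; BSD is not proved by this).

WHY THIS FILE. The lead's twin closer `kanP_of_pub_of_signedMuAnalyticAtTwoPlus` (p612933, `…OfSignedMuAnalytic`) takes EIGHT
Literature named facts as binders. One of them, Faltings' isogeny theorem for elliptic curves over `ℚ` in trace form
(`WeierstrassCurve.isIsogenous_iff_frobeniusTrace_eq`), is no longer debt: the tree PROVES it as
`WeierstrassCurve.isIsogenous_iff_frobeniusTrace_eq_holds` (`Literature/NumberTheory/EllipticCurves/IsogenyFrobeniusTraceHoldsProofs`,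
Bost's Faltings-free route through André's algebraicity criterion over `ℚ`). Feeding that theorem in gives the crux BY NAME from the
SEVEN remaining print facts — Eichler–Shimura (depleted optimal quotient), Mazur–Kenku, Hecke self-duality of `J₀[2]`, Buzzard's
mod-`2` multiplicity one, Serre 1972 Prop. 12, Deligne Weil I Thm. 8.2, Abbes–Ullmo Thm. A — and the EXISTING route item 21437
`SignedMuAnalyticAtTwoPlus`; the pen's twin «KanP» needs one binder fewer. Also the Abbes–Ullmo-free variant with the period-unit
statement PER as an explicit hypothesis.

References: [Faltings1983Endlichkeit] §5 Kor. 2; [Bost2001AlgebraicLeaves] Cor. 2.5; [AbbesUllmo1996] Thm. A; [Pollack2003] Conj. 6.3;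
[GreenbergVatsal2000] §1 (10).
-/

noncomputable section

-- justification: the `Summit.BirchSwinnertonDyer.BirchSwinnertonDyer.…` path repeats a component (route-file convention)
set_option linter.dupNamespace false

open scoped Classical MatrixGroups

open CongruenceSubgroup Literature.NumberTheory.EllipticCurves Literature.NumberTheory.EllipticCurves.ModularForms
open Summit.BirchSwinnertonDyer.BirchSwinnertonDyer.Theses.ResidualThetaTransportAtTwo

namespace Summit.BirchSwinnertonDyer.BirchSwinnertonDyer.Theorems.ThetaLayerLambdaCongruenceAtTwo

/-- **Kan⁺ `ThetaLayerLambdaCongruenceAtTwo` BY NAME from SEVEN Literature named facts + the route item 21437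
`SignedMuAnalyticAtTwoPlus`.** The eighth binder of the lead's closer (Faltings' isogeny theorem in trace form) is supplied by the
tree theorem `WeierstrassCurve.isIsogenous_iff_frobeniusTrace_eq_holds`. Conditional on seven print facts and on an OPEN item;
BSD is not proved by this. [cite: Faltings1983Endlichkeit, §5 Korollar 2] [cite: AbbesUllmo1996, Thm. A]
[cite: Pollack2003, Conj. 6.3 (shape)] -/
theorem thetaLayerLambdaCongruenceAtTwo_of_sevenFacts_signedMuAnalytic
    (hES : eichlerShimura_depletedOptimalQuotient_periodLattice_of_dvd)
    (hMK : mazurKenku_exists_cyclic_isogeny)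
    (hSD : heckeSelfDual_torsionBy_J0) (hBz : buzzard2000_multiplicityOne_gamma0)
    (hSe : serre1972_supersingular_decompositionSubgroup_image)
    (hD : Deligne1974_heckeT_eigenvalue_norm_le)
    (hAU : abbesUllmo_not_dvd_maninConstant_of_not_dvd_level)
    (hμ : SignedMuAnalyticAtTwoPlus) :
    ThetaLayerLambdaCongruenceAtTwo :=
  thetaLayerLambdaCongruenceAtTwo_of_facts_abbesUllmo_signedMuAnalytic hES
    WeierstrassCurve.isIsogenous_iff_frobeniusTrace_eq_holds hMK hSD hBz hSe hD hAU hμ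

/-- **Abbes–Ullmo-free form**: Kan⁺ BY NAME from SIX Literature named facts, the period-unit statement PER at `2` (inline
hypothesis: on the good-supersingular-at-`2` locus the Néron real period is a `2`-adic-unit rational multiple of `Ω⁺_f`) and the
route item 21437; Faltings supplied by the tree theorem. BSD is not proved by this.
[cite: Faltings1983Endlichkeit, §5 Korollar 2] [cite: Pollack2003, Prop. 6.18 (shape)] -/
theorem thetaLayerLambdaCongruenceAtTwo_of_sixFacts_periodUnit_signedMuAnalytic
    (hES : eichlerShimura_depletedOptimalQuotient_periodLattice_of_dvd)
    (hMK : mazurKenku_exists_cyclic_isogeny)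
    (hSD : heckeSelfDual_torsionBy_J0) (hBz : buzzard2000_multiplicityOne_gamma0)
    (hSe : serre1972_supersingular_decompositionSubgroup_image)
    (hD : Deligne1974_heckeT_eigenvalue_norm_le)
    (hper : ∀ (W : WeierstrassCurve ℚ) [W.IsElliptic] [W.IsGloballyMinimal],
      Literature.NumberTheory.EllipticCurves.Rank1Residual.GoodSS W 2 →
      ∀ [NeZero (W.conductorNorm ℤ)] (f : CuspForm (Gamma0 (W.conductorNorm ℤ)) 2), IsNewformOf W f →
      ∃ u : ℚ, ‖(u : ℚ_[2])‖ = 1 ∧ W.realPeriodRat = u * plusPeriod f)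
    (hμ : SignedMuAnalyticAtTwoPlus) :
    ThetaLayerLambdaCongruenceAtTwo :=
  thetaLayerLambdaCongruenceAtTwo_of_facts_periodUnit_signedMuAnalytic hES
    WeierstrassCurve.isIsogenous_iff_frobeniusTrace_eq_holds hMK hSD hBz hSe hD hper hμ

/-- **Curried form for a route binder list** (the pen's twin «KanP» with SEVEN print binders): Eichler–Shimura, Mazur–Kenku,
Hecke self-duality, Buzzard, Serre, Deligne, Abbes–Ullmo, then the item 21437, then the crux — all BY NAME. -/
theorem kanP7_of_pub_of_signedMuAnalyticAtTwoPlus :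
    eichlerShimura_depletedOptimalQuotient_periodLattice_of_dvd → mazurKenku_exists_cyclic_isogeny →
    heckeSelfDual_torsionBy_J0 → buzzard2000_multiplicityOne_gamma0 →
    serre1972_supersingular_decompositionSubgroup_image → Deligne1974_heckeT_eigenvalue_norm_le →
    abbesUllmo_not_dvd_maninConstant_of_not_dvd_level → SignedMuAnalyticAtTwoPlus → ThetaLayerLambdaCongruenceAtTwo :=
  thetaLayerLambdaCongruenceAtTwo_of_sevenFacts_signedMuAnalytic

end Summit.BirchSwinnertonDyer.BirchSwinnertonDyer.Theorems.ThetaLayerLambdaCongruenceAtTwo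

end
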